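import Literature.AlgebraicGeometry.Motives.MotivatedCycles
import Literature.AlgebraicGeometry.Motives.MotivatedCyclesProofs
import Literature.AlgebraicGeometry.Motives.MotivatedCyclesLefschetzProofs
import HarnessLib

/-!
# Motivated cycles modelled on a class `𝒱` of base pieces (André 1996, §0.3 and §2.1 Déf. 1)

Y. André, *Pour une théorie inconditionnelle des motifs*, Publ. Math. IHÉS 83 (1996), fixes
once and for all (§0.3, p. 7; §2.1, p. 13) «une sous-catégorie pleine `𝒱` de la catégorie des
`K`-schémas `X` projectifs lisses, stable par produits, sommes disjointes et composantes
connexes. Les objets de `𝒱` seront les pièces de base du « meccano des motifs »» (footnote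
p. 13: the empty product `Spec K` is in `𝒱`), and Définition 1 (p. 14) defines a motivated
cycle on `X` as a class `pr^{XY}_{X*} (α ∪ ⋆β)` with `α`, `β` algebraic on `X × Y`, «avec `Y`
arbitraire dans `𝒱`». The resulting algebra is `A_mot(X)` — «Nous appellerons cycles motivés
(modelés sur `𝒱`) les éléments de `A_mot(X)` (cette notion se réduit à celle de cycle
algébrique si pour tout objet de `𝒱` l'involution `⋆_L` est donnée par une correspondance
algébrique)» (§0.3, p. 7) — and it genuinely depends on `𝒱`: for `𝒱 = 𝒜b` (products of
abelian varieties) motivated cycles are algebraic (§6.2, p. 31, by Lieberman), while the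
sharp form of Théorème 0.6.2 (p. 9) says that Hodge cycles on complex abelian varieties are
motivated as soon as `𝒱` contains the abelian varieties and the total spaces of compact
pencils of abelian varieties (§6.3, p. 31, and Remarque 2, p. 33).

The tree's `WeilCohomology.IsMotivatedClass` / `WeilCohomology.motivatedClasses`
(`Motives/MotivatedCycles.lean`) take `𝒱 =` all smooth projective varieties. This file
vendors the **`𝒱`-relative notion**: the same relational definition with the auxiliary
variety `Y` restricted to a class `𝒱 : Set (SchemeOver k)`, its `K`-span and `ℚ`-space, the
product closure of a class of varieties (André's «stable par produits»), and it **proves**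
André's parenthesis «`A_mot(X) = A(X)` si pour tout schéma `Y` dans `𝒱`, polarisé,
l'involution de Lefschetz est donnée par une correspondance algébrique» (§2.1, p. 14; §0.3)
in the sharp, `𝒱`-relative form that the reduction of the Hodge conjecture for abelian
varieties to conjecture `B` for compact abelian pencils (Remarque 2, p. 33) consumes:
Grothendieck's `B` (in `θ`-form, for the hyperplane classes of the auxiliary products
`X × Y`, `Y ∈ 𝒱`) implies `A_mot^p(X)_𝒱 ⊆ Aᵖ(X)_ℚ`, by the argument of the tree's
`WeilCohomology.mem_ratAlgebraicClasses_of_isMotivatedClass` (Kleiman 1968 Prop. 2.3: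
`B ⇒ ⋆` algebraic) run one auxiliary piece at a time.

## Main definitions

* `WeilCohomology.IsMotivatedClassModelledOn W 𝒱 n X p x` : `x ∈ H²ᵖ(X)` is
  `pr_{X*} (α ∪ ⋆β)` for some auxiliary `Y ∈ 𝒱` (André 1996 Déf. 1 with «`Y` arbitraire dans
  `𝒱`»; relational form of `pr_{X*}` exactly as in `IsMotivatedClass`).
* `WeilCohomology.motivatedClassesModelledOn W 𝒱 n X p` : their `K`-span `A_mot^p(X)_𝒱 ⊗ K`;
  `WeilCohomology.ratMotivatedClassesModelledOn W 𝒱 n X p` : the subgroup they generate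
  (André's `ℚ`-space: «`ξ` est somme de cycles de la forme `p_*(α ∪ ⋆_L β)`», Thm. 0.6.2).
* `IsProdClosed 𝒱`, `prodClosure 𝒱` : stability of a class of `k`-schemes under the product
  `⊗` of `SchemeOver k`, and the smallest product-stable class containing `𝒱` (André's
  «stable par produits»).

## Main statements (all proved)

* `isMotivatedClassModelledOn_univ_iff`, `motivatedClassesModelledOn_univ` : for `𝒱 = univ`
  the notion is the tree's `IsMotivatedClass` / `motivatedClasses`; `IsMotivatedClassModelledOn.mono`,
  `motivatedClassesModelledOn_mono` : monotone in `𝒱`.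
* `IsMotivatedClassModelledOn.mem_ratAlgebraicClasses` : **`B` on the auxiliary products
  `X × Y`, `Y ∈ 𝒱`, implies that every motivated class modelled on `𝒱` is rational
  algebraic** (André 1996 §2.1 p. 14 / §0.3; Kleiman 1968 Prop. 2.3), hence
  `motivatedClassesModelledOn_le_algebraicClasses` (`A_mot^p(X)_𝒱 ≤ Aᵖ(X)`), and for a
  product-stable `𝒱 ∋ X` on all of whose members `B` holds,
  `motivatedClassesModelledOn_le_algebraicClasses_of_isProdClosed`.
* `isMotivatedClassModelledOn_of_mem_ratAlgebraicClasses` : conversely `Aᵖ(X)_ℚ ⊆ A_mot^p(X)_𝒱`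
  as soon as `𝒱` contains one smooth projective variety of positive dimension (André: «Il est
  clair que `A_mot(X)_E` contient `A(X)`», p. 14; the tree's proof with `ℙ¹` replaced by that
  piece), whence `motivatedClassesModelledOn_eq_algebraicClasses`.

## Design choices

* `𝒱` is a `Set (SchemeOver k)` (André: a class of objects, i.e. a full subcategory). The
  dimension of the auxiliary piece is not an index of `𝒱`: it is carried, as everywhere on
  this layer, by the witness `IsSmoothProjective m Y` inside the definition (a requester's
  `ℕ`-indexed predicate `𝒱' m Y` is recovered as `{Y | ∃ m, 𝒱' m Y}`). Membership `X ∈ 𝒱` of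
  the variety itself is **not** part of the definition of a motivated class on `X` (only the
  auxiliary piece is restricted); statements that need it (`…_of_isProdClosed`) take it as a
  hypothesis, as André's standing convention `X ∈ 𝒱` suggests.
* Of André's three closure conditions only stability under products is rendered
  (`IsProdClosed`, `prodClosure`): disjoint sums and connected components have no counterpart
  for the geometrically integral `IsSmoothProjective` varieties of this layer (the same
  convention as `Motives/MotivatedCyclesProduct.lean`, whose docstring discusses André's
  `E`-linearity via disjoint unions; here too the objects of study are spans).
* Polarisations: as in `IsMotivatedClass`, the auxiliary product `X × Y` is polarised by an
  arbitrary hyperplane class `η` of `X × Y` and `⋆` is any operator with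
  `W.IsLefschetzStar (n + m) η S`, whereas André polarises `X × Y` by the product polarisation
  `[X] ⊗ η_Y + η_X ⊗ [Y]` (Déf. 1; vendored verbatim, for `𝒱 = univ`, as
  `WeilCohomology.IsProdMotivatedClass` in `Motives/MotivatedCyclesProduct.lean`, whose module
  docstring compares the two forms in this axiomatics). For the classical cohomology theories
  the two families of generators span the same space for every `𝒱` (André 1996 §3.2,
  Remarque p. 21, applied to the object `X × Y` of `𝒱`: the Lefschetz involution of any other
  polarisation is a motivated correspondence modelled on `𝒱`; and product polarisations are
  hyperplane classes by the Segre embedding), so nothing of André's `A_mot(X)_𝒱` is lost; the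
  hyperplane-class form is the one in which the consumer's hypotheses are stated (conjecture
  `B(Y, η)` for hyperplane classes `η`, `WeilCohomology.StandardConjectureB`), and in which
  `B ⇒ A_mot,𝒱 ⊆ A` is provable from the C-lite axioms (this file).
* Hard Lefschetz (`W.HasHardLefschetz`) is André's standing hypothesis on the reference
  cohomology («vérifiant le théorème de Lefschetz fort», p. 14) and is carried explicitly.
* Mathlib has no Weil-cohomology / motivated-cycle vocabulary (searched `motivated`,
  `Lefschetz`, `modelled`); the closure `prodClosure` is a four-line inductive predicate rather
  than `Subsemigroup.closure`, the monoidal product of `SchemeOver k` not being a `Mul`.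

## References

* Y. André, *Pour une théorie inconditionnelle des motifs*, Publ. Math. IHÉS 83 (1996), 5–49:
  §0.3 (p. 7: `𝒱`, «pièces de base», Thm. 0.3, «cycles motivés (modelés sur `𝒱`)» and the
  parenthesis on algebraicity), §2.1 (pp. 13–14: Déf. 1, footnote on the empty product, the
  remark «`A_mot(X)_E` contient `A(X)` … `A_mot(X) = A(X)` si … l'involution de Lefschetz est
  donnée par une correspondance algébrique»), §3.2 Remarque (p. 21), §6.2–6.3 (p. 31),
  Thm. 0.6.2 (p. 9), §6.3 Remarque 2 (p. 33). [Andre1996Motifs]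
* S. Kleiman, *Algebraic cycles and the Weil conjectures*, in: Dix exposés sur la cohomologie
  des schémas (1968), §1.3, §1.4, Prop. 2.3 (`B ⇒ ⋆` algebraic), §2 (stability of `B` under
  products, as cited by the tree's `WeilCohomology.standardConjectureB_tensor_self`). [Kleiman1968AlgebraicCycles]
-/

universe u v

open CategoryTheory AlgebraicGeometry MonoidalCategory CartesianMonoidalCategory
open scoped TensorProduct

noncomputable section

namespace Literature.AlgebraicGeometry.Motives

/-! ## Classes of base pieces stable under products -/

section ProdClosure

variable {k : Type u} [Field k]

/-- A class `𝒱` of `k`-schemes *is stable under products*: `Y, Z ∈ 𝒱 ⇒ Y × Z ∈ 𝒱` (the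
product `Y ⊗ Z` of `SchemeOver k`). André's base pieces form such a class («stable par
produits», the empty product `Spec K` included by convention). [cite: Andre1996Motifs, §2.1 (p. 13) and §0.3 (p. 7)] -/
def IsProdClosed (𝒱 : Set (SchemeOver k)) : Prop :=
  ∀ ⦃Y : SchemeOver k⦄, Y ∈ 𝒱 → ∀ ⦃Z : SchemeOver k⦄, Z ∈ 𝒱 → Y ⊗ Z ∈ 𝒱

/-- The inductive generation of the product closure of a class of `k`-schemes: members of `𝒱`,
and products `Y ⊗ Z` of two members of the closure. [folklore] -/
inductive InProdClosure (𝒱 : Set (SchemeOver k)) : SchemeOver k → Prop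
  /-- Members of `𝒱` are in its product closure. -/
  | of_mem {Y : SchemeOver k} : Y ∈ 𝒱 → InProdClosure 𝒱 Y
  /-- The product closure is stable under `⊗`. -/
  | tensor {Y Z : SchemeOver k} : InProdClosure 𝒱 Y → InProdClosure 𝒱 Z → InProdClosure 𝒱 (Y ⊗ Z)

/-- The **product closure** of a class `𝒱` of `k`-schemes: the smallest class containing `𝒱`
and stable under products (`subset_prodClosure`, `isProdClosed_prodClosure`,
`prodClosure_subset`). Used to generate André's classes of base pieces from a family of
generators (e.g. abelian varieties and compact abelian pencils, Thm. 0.6.2: auxiliary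
varieties `B × Y₁ × ⋯ × Y_k`). [cite: Andre1996Motifs, §0.3 (p. 7) and Thm. 0.6.2 (p. 9)] -/
def prodClosure (𝒱 : Set (SchemeOver k)) : Set (SchemeOver k) :=
  {Y | InProdClosure 𝒱 Y}

/-- Membership in the product closure, unfolded. [folklore] -/
lemma mem_prodClosure_iff {𝒱 : Set (SchemeOver k)} {Y : SchemeOver k} :
    Y ∈ prodClosure 𝒱 ↔ InProdClosure 𝒱 Y :=
  Iff.rfl

/-- `𝒱 ⊆ prodClosure 𝒱`. [folklore] -/
lemma subset_prodClosure (𝒱 : Set (SchemeOver k)) : 𝒱 ⊆ prodClosure 𝒱 :=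
  fun _ hY ↦ InProdClosure.of_mem hY

/-- The product closure is stable under products. [folklore] -/
lemma isProdClosed_prodClosure (𝒱 : Set (SchemeOver k)) : IsProdClosed (prodClosure 𝒱) :=
  fun _ hY _ hZ ↦ InProdClosure.tensor hY hZ

/-- Products of members of the product closure are members. [folklore] -/
lemma tensor_mem_prodClosure {𝒱 : Set (SchemeOver k)} {Y Z : SchemeOver k}
    (hY : Y ∈ prodClosure 𝒱) (hZ : Z ∈ prodClosure 𝒱) : Y ⊗ Z ∈ prodClosure 𝒱 :=
  isProdClosed_prodClosure 𝒱 hY hZ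

/-- Minimality: a product-stable class containing `𝒱` contains `prodClosure 𝒱`. [folklore] -/
lemma prodClosure_subset {𝒱 𝒲 : Set (SchemeOver k)} (h : 𝒱 ⊆ 𝒲) (h𝒲 : IsProdClosed 𝒲) :
    prodClosure 𝒱 ⊆ 𝒲 := by
  intro Y hY
  induction hY with
  | of_mem hY => exact h hY
  | tensor _ _ ihY ihZ => exact h𝒲 ihY ihZ

/-- A product-stable class is its own product closure. [folklore] -/
lemma IsProdClosed.prodClosure_eq {𝒱 : Set (SchemeOver k)} (h : IsProdClosed 𝒱) :
    prodClosure 𝒱 = 𝒱 :=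
  Set.Subset.antisymm (prodClosure_subset le_rfl h) (subset_prodClosure 𝒱)

/-- The product closure is monotone. [folklore] -/
lemma prodClosure_mono {𝒱 𝒲 : Set (SchemeOver k)} (h : 𝒱 ⊆ 𝒲) :
    prodClosure 𝒱 ⊆ prodClosure 𝒲 :=
  prodClosure_subset (h.trans (subset_prodClosure 𝒲)) (isProdClosed_prodClosure 𝒲)

/-- If every member of `𝒱` is a smooth projective variety (of some dimension), so is every
member of its product closure (products of smooth projective varieties are smooth projective:
the discharged fact `IsSmoothProjective.tensor`, Segre embedding). [folklore] -/
lemma exists_isSmoothProjective_of_mem_prodClosure {𝒱 : Set (SchemeOver k)}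
    (h : ∀ Y ∈ 𝒱, ∃ m, IsSmoothProjective m Y) {Y : SchemeOver k} (hY : Y ∈ prodClosure 𝒱) :
    ∃ m, IsSmoothProjective m Y := by
  induction hY with
  | of_mem hY => exact h _ hY
  | tensor _ _ ihY ihZ =>
    obtain ⟨m, hm⟩ := ihY
    obtain ⟨m', hm'⟩ := ihZ
    exact ⟨m + m', IsSmoothProjective.tensor_holds hm hm'⟩

end ProdClosure

/-! ## Motivated classes modelled on `𝒱` -/

namespace WeilCohomology

variable {k : Type u} [Field k] {K : Type v} [Field K] [CharZero K] (W : WeilCohomology k K)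

/-- A class `x ∈ H²ᵖ(X)` (`X` smooth projective of dimension `n`) *is a motivated class
modelled on `𝒱`* (André 1996, Déf. 1 with «`Y` arbitraire dans `𝒱`», §0.3 «cycles motivés
(modelés sur `𝒱`)»): there are an auxiliary base piece `Y ∈ 𝒱`, smooth projective of
dimension `m`, a hyperplane class `η` on `X × Y` with a Lefschetz involution `⋆ = S`
(`W.IsLefschetzStar (n + m) η S`), and rational algebraic classes `α ∈ Aᵃ(X × Y)_ℚ`,
`β ∈ Aᵇ(X × Y)_ℚ` (with `⋆β ∈ H^{2b'}`, `b + b' = n + m`, `a + b' = p + m`) such that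
`x = pr_{X*} (α ∪ ⋆β)`, the push-forward being expressed by the projection formula: for every
`y ∈ H^{2q}(X)`, `p + q = n`, `tr_X (x ∪ y) = tr_{X×Y} ((α ∪ ⋆β) ∪ pr_X* y)`. Verbatim the
tree's `IsMotivatedClass` with the extra constraint `Y ∈ 𝒱` (`isMotivatedClassModelledOn_univ_iff`);
see the module docstring (Design choices) for the comparison with André's product
polarisations. [cite: Andre1996Motifs, §2.1 Déf. 1 (p. 14) and §0.3 (p. 7)] -/
def IsMotivatedClassModelledOn (𝒱 : Set (SchemeOver k)) (n : ℕ) (X : SchemeOver k) (p : ℕ)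
    (x : W.obj X (2 * p)) : Prop :=
  ∃ (m : ℕ) (Y : SchemeOver k) (_ : Y ∈ 𝒱) (_ : IsSmoothProjective m Y) (η : W.obj (X ⊗ Y) 2)
    (_ : W.IsHyperplaneClass (X ⊗ Y) η) (S : W.GradedOp (X ⊗ Y) (X ⊗ Y))
    (_ : W.IsLefschetzStar (n + m) η S) (a b b' : ℕ) (_ : b + b' = n + m)
    (hab : a + b' = p + m) (α : W.obj (X ⊗ Y) (2 * a)) (β : W.obj (X ⊗ Y) (2 * b)),
    α ∈ W.ratAlgebraicClasses (X ⊗ Y) a ∧ β ∈ W.ratAlgebraicClasses (X ⊗ Y) b ∧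
      ∀ (q : ℕ) (hq : p + q = n) (y : W.obj X (2 * q)),
        W.cupPairing X n (2 * p) (2 * q) (by omega) x y =
          W.trace (X ⊗ Y) (n + m)
            (W.cup (show 2 * (p + m) + 2 * q = 2 * (n + m) by omega)
              (W.cup (show 2 * a + 2 * b' = 2 * (p + m) by omega) α (S (2 * b) (2 * b') β))
              (W.pullback (fst X Y) (2 * q) y))

/-- The `K`-subspace `A_mot^p(X)_𝒱 ⊗ K ⊆ H²ᵖ(X)` of **motivated classes modelled on `𝒱`**:
the span of the classes `pr_{X*} (α ∪ ⋆β)` with auxiliary piece in `𝒱`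
(`W.IsMotivatedClassModelledOn`); André 1996 §2.1 (`A_mot(X)`, Déf. 1 and Prop. 2.1) and §0.3.
[cite: Andre1996Motifs, §2.1 Déf. 1 (p. 14) and §0.3 (p. 7)] -/
def motivatedClassesModelledOn (𝒱 : Set (SchemeOver k)) (n : ℕ) (X : SchemeOver k) (p : ℕ) :
    Submodule K (W.obj X (2 * p)) :=
  Submodule.span K {x | W.IsMotivatedClassModelledOn 𝒱 n X p x}

/-- The subgroup `A_mot^p(X)_𝒱` of `H²ᵖ(X)` generated by the motivated classes modelled on `𝒱`
— André's `ℚ`-space (the generating set is stable under `ℚ`, since `α`, `β` range over the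
divisible groups `A(X × Y)_ℚ`): its elements are the finite sums of classes `pr_{X*} (α ∪ ⋆β)`,
`Y ∈ 𝒱`, the form in which Thm. 0.6.2 is printed («`ξ` est somme de cycles de la forme
`p_*(α ∪ ⋆_L(β))`»). Its `K`-span is `motivatedClassesModelledOn`
(`span_ratMotivatedClassesModelledOn`). [cite: Andre1996Motifs, §2.1 Déf. 1 (p. 14) and Thm. 0.6.2 (p. 9)] -/
def ratMotivatedClassesModelledOn (𝒱 : Set (SchemeOver k)) (n : ℕ) (X : SchemeOver k)
    (p : ℕ) : AddSubgroup (W.obj X (2 * p)) :=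
  AddSubgroup.closure {x | W.IsMotivatedClassModelledOn 𝒱 n X p x}

variable {W}
variable {𝒱 𝒲 : Set (SchemeOver k)} {n : ℕ} {X : SchemeOver k}

/-! ### Unfolding, monotonicity, comparison with `IsMotivatedClass` -/

/-- A motivated class modelled on `𝒱` lies in `motivatedClassesModelledOn 𝒱`. [folklore] -/
lemma IsMotivatedClassModelledOn.mem_motivatedClassesModelledOn {p : ℕ} {x : W.obj X (2 * p)}
    (hx : W.IsMotivatedClassModelledOn 𝒱 n X p x) : x ∈ W.motivatedClassesModelledOn 𝒱 n X p :=
  Submodule.subset_span hx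

/-- A motivated class modelled on `𝒱` lies in `ratMotivatedClassesModelledOn 𝒱`. [folklore] -/
lemma IsMotivatedClassModelledOn.mem_ratMotivatedClassesModelledOn {p : ℕ} {x : W.obj X (2 * p)}
    (hx : W.IsMotivatedClassModelledOn 𝒱 n X p x) :
    x ∈ W.ratMotivatedClassesModelledOn 𝒱 n X p :=
  AddSubgroup.subset_closure hx

/-- `motivatedClassesModelledOn 𝒱` is the smallest subspace containing the motivated classes
modelled on `𝒱`. [folklore] -/
lemma motivatedClassesModelledOn_le_iff {p : ℕ} {V : Submodule K (W.obj X (2 * p))} :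
    W.motivatedClassesModelledOn 𝒱 n X p ≤ V ↔
      ∀ x, W.IsMotivatedClassModelledOn 𝒱 n X p x → x ∈ V :=
  Submodule.span_le

/-- `A_mot^p(X)_𝒱` (with `ℚ`-coefficients) is contained in its `K`-span. [folklore] -/
lemma ratMotivatedClassesModelledOn_subset_motivatedClassesModelledOn (p : ℕ) :
    (W.ratMotivatedClassesModelledOn 𝒱 n X p : Set (W.obj X (2 * p))) ⊆
      W.motivatedClassesModelledOn 𝒱 n X p :=
  (AddSubgroup.closure_le (W.motivatedClassesModelledOn 𝒱 n X p).toAddSubgroup).mpr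
    Submodule.subset_span

/-- The `K`-span of `A_mot^p(X)_𝒱` is `motivatedClassesModelledOn 𝒱`. [folklore] -/
lemma span_ratMotivatedClassesModelledOn (p : ℕ) :
    Submodule.span K (W.ratMotivatedClassesModelledOn 𝒱 n X p : Set (W.obj X (2 * p))) =
      W.motivatedClassesModelledOn 𝒱 n X p :=
  le_antisymm (Submodule.span_le.mpr (ratMotivatedClassesModelledOn_subset_motivatedClassesModelledOn p))
    (Submodule.span_mono fun _ hx ↦ AddSubgroup.subset_closure hx)

/-- **Monotonicity in the class of base pieces**: enlarging `𝒱` can only produce more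
motivated classes. [folklore] -/
lemma IsMotivatedClassModelledOn.mono (h : 𝒱 ⊆ 𝒲) {p : ℕ} {x : W.obj X (2 * p)}
    (hx : W.IsMotivatedClassModelledOn 𝒱 n X p x) : W.IsMotivatedClassModelledOn 𝒲 n X p x := by
  obtain ⟨m, Y, hY, hx⟩ := hx
  exact ⟨m, Y, h hY, hx⟩

/-- `A_mot^p(X)_𝒱 ≤ A_mot^p(X)_𝒲` for `𝒱 ⊆ 𝒲`. [folklore] -/
lemma motivatedClassesModelledOn_mono (h : 𝒱 ⊆ 𝒲) (p : ℕ) :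
    W.motivatedClassesModelledOn 𝒱 n X p ≤ W.motivatedClassesModelledOn 𝒲 n X p :=
  Submodule.span_mono fun _ hx ↦ IsMotivatedClassModelledOn.mono h hx

/-- `A_mot^p(X)_𝒱 ≤ A_mot^p(X)_𝒲` for `𝒱 ⊆ 𝒲`, `ℚ`-coefficients. [folklore] -/
lemma ratMotivatedClassesModelledOn_mono (h : 𝒱 ⊆ 𝒲) (p : ℕ) :
    W.ratMotivatedClassesModelledOn 𝒱 n X p ≤ W.ratMotivatedClassesModelledOn 𝒲 n X p :=
  AddSubgroup.closure_mono fun _ hx ↦ IsMotivatedClassModelledOn.mono h hx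

/-- A motivated class is modelled on the single piece it uses: `x` is modelled on `𝒱` iff it
is modelled on `{Y}` for some `Y ∈ 𝒱`. [folklore] -/
lemma isMotivatedClassModelledOn_iff_exists_singleton {p : ℕ} {x : W.obj X (2 * p)} :
    W.IsMotivatedClassModelledOn 𝒱 n X p x ↔
      ∃ Y ∈ 𝒱, W.IsMotivatedClassModelledOn {Y} n X p x := by
  refine ⟨fun ⟨m, Y, hY, hx⟩ ↦ ⟨Y, hY, m, Y, rfl, hx⟩, fun ⟨Y, hY, hx⟩ ↦ ?_⟩
  exact hx.mono (Set.singleton_subset_iff.mpr hY)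

/-- **For `𝒱 =` all varieties the notion is the tree's `IsMotivatedClass`** (André's Déf. 1
for the largest class of base pieces). [cite: Andre1996Motifs, §2.1 Déf. 1 (p. 14)] -/
lemma isMotivatedClassModelledOn_univ_iff {p : ℕ} {x : W.obj X (2 * p)} :
    W.IsMotivatedClassModelledOn Set.univ n X p x ↔ W.IsMotivatedClass n X p x :=
  ⟨fun ⟨m, Y, _, hx⟩ ↦ ⟨m, Y, hx⟩, fun ⟨m, Y, hx⟩ ↦ ⟨m, Y, Set.mem_univ Y, hx⟩⟩

/-- A motivated class modelled on any `𝒱` is a motivated class. [folklore] -/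
lemma IsMotivatedClassModelledOn.isMotivatedClass {p : ℕ} {x : W.obj X (2 * p)}
    (hx : W.IsMotivatedClassModelledOn 𝒱 n X p x) : W.IsMotivatedClass n X p x :=
  isMotivatedClassModelledOn_univ_iff.mp (hx.mono (Set.subset_univ 𝒱))

/-- `motivatedClassesModelledOn univ = motivatedClasses`. [cite: Andre1996Motifs, §2.1 Déf. 1 (p. 14)] -/
lemma motivatedClassesModelledOn_univ (p : ℕ) :
    W.motivatedClassesModelledOn Set.univ n X p = W.motivatedClasses n X p := by
  simp only [motivatedClassesModelledOn, motivatedClasses, isMotivatedClassModelledOn_univ_iff]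

/-- `ratMotivatedClassesModelledOn univ = ratMotivatedClasses`. [cite: Andre1996Motifs, §2.1 Déf. 1 (p. 14)] -/
lemma ratMotivatedClassesModelledOn_univ (p : ℕ) :
    W.ratMotivatedClassesModelledOn Set.univ n X p = W.ratMotivatedClasses n X p := by
  simp only [ratMotivatedClassesModelledOn, ratMotivatedClasses, isMotivatedClassModelledOn_univ_iff]

/-- `A_mot^p(X)_𝒱 ≤ A_mot^p(X)` (the tree's motivated classes, all auxiliary varieties
allowed). [folklore] -/
lemma motivatedClassesModelledOn_le_motivatedClasses (p : ℕ) :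
    W.motivatedClassesModelledOn 𝒱 n X p ≤ W.motivatedClasses n X p :=
  (motivatedClassesModelledOn_mono (Set.subset_univ 𝒱) p).trans (motivatedClassesModelledOn_univ p).le

/-- The data of a motivated class modelled on `𝒱` exhibit a smooth projective piece of `𝒱`.
[folklore] -/
lemma IsMotivatedClassModelledOn.exists_mem {p : ℕ} {x : W.obj X (2 * p)}
    (hx : W.IsMotivatedClassModelledOn 𝒱 n X p x) : ∃ Y ∈ 𝒱, ∃ m, IsSmoothProjective m Y := by
  obtain ⟨m, Y, hY, hYsp, -⟩ := hx
  exact ⟨Y, hY, m, hYsp⟩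

/-! ### Motivated classes modelled on `𝒱` are algebraic under `B` on the pieces `X × Y`, `Y ∈ 𝒱` -/

/-- **Motivated classes modelled on `𝒱` are algebraic as soon as the Lefschetz involutions of
the auxiliary products are algebraic** (André 1996 §2.1, remark following Déf. 1, p. 14:
«`A_mot(X) = A(X)` si pour tout schéma `Y` dans `𝒱`, polarisé, l'involution de Lefschetz est
donnée par une correspondance algébrique»; §0.3, parenthesis following Thm. 0.3; Kleiman 1968
Prop. 2.3 for `B ⇒ ⋆` algebraic), in the sharp `𝒱`-relative form: assume hard Lefschetz and
Grothendieck's standard conjecture of Lefschetz type in `θ`-form for the products `X × Y`,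
`Y ∈ 𝒱` smooth projective of dimension `m`, and all their hyperplane classes
(`W.StandardConjectureB (n + m) (X ⊗ Y) η`). Then every motivated class
`x = pr_{X*} (α ∪ ⋆β)` modelled on `𝒱` lies in `Aᵖ(X)_ℚ`: `⋆β` is rational algebraic
(`isRatInduced_of_isLefschetzStar`, `map_ratAlgebraicClasses_of_isInducedBy`), hence so is
`α ∪ ⋆β`, `x` is its push-forward by perfectness of the Poincaré pairing, and `pr_{X*}`
preserves rational algebraic classes (`pushforward_fst_mem_ratAlgebraicClasses`). The proof is
that of the tree's `mem_ratAlgebraicClasses_of_isMotivatedClass` with `B` used only on the one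
auxiliary product that occurs. [cite: Andre1996Motifs, §2.1 remark following Déf. 1 (p. 14) and §0.3 (p. 7)] -/
theorem IsMotivatedClassModelledOn.mem_ratAlgebraicClasses (hL : W.HasHardLefschetz)
    (hB : ∀ ⦃m : ℕ⦄ ⦃Y : SchemeOver k⦄, Y ∈ 𝒱 → IsSmoothProjective m Y →
      ∀ ⦃η : W.obj (X ⊗ Y) 2⦄, W.IsHyperplaneClass (X ⊗ Y) η →
        W.StandardConjectureB (n + m) (X ⊗ Y) η)
    (hX : IsSmoothProjective n X) {p : ℕ} {x : W.obj X (2 * p)}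
    (hx : W.IsMotivatedClassModelledOn 𝒱 n X p x) : x ∈ W.ratAlgebraicClasses X p := by
  obtain ⟨m, Y, hY𝒱, hY, η, hη, S, hS, a, b, b', hbb', hab, α, β, hα, hβ, hproj⟩ := hx
  have hXY := IsSmoothProjective.tensor_holds hX hY
  -- `⋆β` is rational algebraic (Kleiman 1968 Prop. 2.3 on `X × Y`)
  have hSβ : S (2 * b) (2 * b') β ∈ W.ratAlgebraicClasses (X ⊗ Y) b' := by
    obtain ⟨u, hu, hind⟩ := isRatInduced_of_isLefschetzStar (hB hY𝒱 hY hη) hL hXY hη hS (2 * b)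
      (2 * b') (2 * b) (2 * b') (by omega) (by omega)
    exact W.map_ratAlgebraicClasses_of_isInducedBy hXY hXY u _ _ _ hu hind β hβ
  -- hence so is `z = α ∪ ⋆β`
  have hz : W.cup (show 2 * a + 2 * b' = 2 * (p + m) by omega) α (S (2 * b) (2 * b') β) ∈
      W.ratAlgebraicClasses (X ⊗ Y) (p + m) :=
    W.cup_mem_ratAlgebraicClasses hXY (by omega) _ _ hα hSβ
  -- above the top degree there is nothing to prove
  by_cases hp : n < p
  · haveI := W.subsingleton_obj hX (i := 2 * p) (by omega)
    rw [Subsingleton.elim x 0]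
    exact zero_mem _
  obtain ⟨q, hq⟩ : ∃ q, p + q = n := ⟨n - p, by omega⟩
  have he : 2 * (p + m) + 2 * q = 2 * (n + m) := by omega
  have hd : 2 * p + 2 * q = 2 * n := by omega
  -- `x` is the push-forward of `z`
  have hxz : x = W.pushforward (N := n + m) hX (fst X Y) he hd
      (W.cup (show 2 * a + 2 * b' = 2 * (p + m) by omega) α (S (2 * b) (2 * b') β)) := by
    haveI := W.isPerfPair_cupPairing hX (2 * p) (2 * q) hd
    refine (LinearMap.IsPerfPair.bijective_left (W.cupPairing X n (2 * p) (2 * q) hd)).1 ?_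
    ext y
    rw [hproj q hq y, PreWeilCohomology.cupPairing, LinearMap.compr₂_apply, W.trace_cup_pushforward]
  rw [hxz]
  exact pushforward_fst_mem_ratAlgebraicClasses hX hY he hd hz

/-- Under hard Lefschetz and `B` for the auxiliary products `X × Y`, `Y ∈ 𝒱` (all hyperplane
classes), the span of the motivated classes modelled on `𝒱` is contained in the span of the
algebraic classes: `A_mot^p(X)_𝒱 ≤ Aᵖ(X)` as `K`-subspaces of `H²ᵖ(X)`.
[cite: Andre1996Motifs, §2.1 remark following Déf. 1 (p. 14)] -/
theorem motivatedClassesModelledOn_le_algebraicClasses (hL : W.HasHardLefschetz)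
    (hB : ∀ ⦃m : ℕ⦄ ⦃Y : SchemeOver k⦄, Y ∈ 𝒱 → IsSmoothProjective m Y →
      ∀ ⦃η : W.obj (X ⊗ Y) 2⦄, W.IsHyperplaneClass (X ⊗ Y) η →
        W.StandardConjectureB (n + m) (X ⊗ Y) η)
    (hX : IsSmoothProjective n X) (p : ℕ) :
    W.motivatedClassesModelledOn 𝒱 n X p ≤ W.algebraicClasses X p :=
  Submodule.span_le.mpr fun _ hx ↦
    W.ratAlgebraicClasses_le_algebraicClasses X p (hx.mem_ratAlgebraicClasses hL hB hX)

/-- The same with `ℚ`-coefficients: `A_mot^p(X)_𝒱 ≤ Aᵖ(X)_ℚ`. [cite: Andre1996Motifs, §2.1 remark following Déf. 1 (p. 14)] -/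
theorem ratMotivatedClassesModelledOn_le_ratAlgebraicClasses (hL : W.HasHardLefschetz)
    (hB : ∀ ⦃m : ℕ⦄ ⦃Y : SchemeOver k⦄, Y ∈ 𝒱 → IsSmoothProjective m Y →
      ∀ ⦃η : W.obj (X ⊗ Y) 2⦄, W.IsHyperplaneClass (X ⊗ Y) η →
        W.StandardConjectureB (n + m) (X ⊗ Y) η)
    (hX : IsSmoothProjective n X) (p : ℕ) :
    W.ratMotivatedClassesModelledOn 𝒱 n X p ≤ W.ratAlgebraicClasses X p :=
  (AddSubgroup.closure_le _).mpr fun _ hx ↦ hx.mem_ratAlgebraicClasses hL hB hX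

/-- **André's parenthesis in its printed form, for a product-stable class of base pieces**
(«cette notion se réduit à celle de cycle algébrique si pour tout objet de `𝒱` l'involution
`⋆_L` est donnée par une correspondance algébrique», §0.3 p. 7; §2.1 p. 14): if `𝒱` is stable
under products, contains `X`, consists of smooth projective varieties, and Grothendieck's `B`
(`θ`-form, every hyperplane class) holds for every member of `𝒱` — so in particular for the
auxiliary products `X × Y ∈ 𝒱` — then `A_mot^p(X)_𝒱 ≤ Aᵖ(X)`. [cite: Andre1996Motifs, §0.3 (p. 7) and §2.1 (p. 14)] -/
theorem motivatedClassesModelledOn_le_algebraicClasses_of_isProdClosed (hL : W.HasHardLefschetz)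
    (h𝒱 : IsProdClosed 𝒱)
    (hB𝒱 : ∀ ⦃m : ℕ⦄ ⦃Z : SchemeOver k⦄, Z ∈ 𝒱 → IsSmoothProjective m Z →
      ∀ ⦃η : W.obj Z 2⦄, W.IsHyperplaneClass Z η → W.StandardConjectureB m Z η)
    (hX𝒱 : X ∈ 𝒱) (hX : IsSmoothProjective n X) (p : ℕ) :
    W.motivatedClassesModelledOn 𝒱 n X p ≤ W.algebraicClasses X p :=
  motivatedClassesModelledOn_le_algebraicClasses hL
    (fun _ _ hY𝒱 hY _ hη ↦ hB𝒱 (h𝒱 hX𝒱 hY𝒱) (IsSmoothProjective.tensor_holds hX hY) hη) hX p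

/-! ### Algebraic classes are motivated modelled on any class with a positive-dimensional piece -/

/-- Positive powers of a hyperplane class are rational algebraic (`pow_succ_mem_ratAlgebraicClasses`
with the exponent written as `r`, `1 ≤ r`). [folklore] -/
lemma pow_mem_ratAlgebraicClasses_of_pos {N : ℕ} {V : SchemeOver k} (hV : IsSmoothProjective N V)
    {η : W.obj V 2} (hη : W.IsHyperplaneClass V η) {r : ℕ} (hr : 1 ≤ r) :
    W.pow V η r ∈ W.ratAlgebraicClasses V r := by
  obtain ⟨j, rfl⟩ : ∃ j, r = j + 1 := ⟨r - 1, by omega⟩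
  exact W.pow_succ_mem_ratAlgebraicClasses hV (W.mem_ratAlgebraicClasses_of_isHyperplaneClass hV hη) j

/-- **Every rational algebraic class is motivated modelled on `𝒱`, for any `𝒱` containing a
smooth projective variety `Y` of positive dimension `m`** (André 1996 §2.1, remark after Déf. 1,
p. 14: «Il est clair que `A_mot(X)_E` contient `A(X)` … (prendre `α` ou `β` égal à la classe
fondamentale de `X × Y`)»). The tree's proof of `isMotivatedClass_of_mem_ratAlgebraicClasses`
with its auxiliary `ℙ¹` replaced by `Y`: `β = ηⁿ⁺ᵐ` for a hyperplane class `η` of `X × Y`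
(`⋆β = 1`, Kleiman's normalisation, `isLefschetzStar_apply_pow`), and
`α = d⁻¹ · (pr_X* x ∪ pr_Y* η_Yᵐ)` with `η_Y` a hyperplane class of `Y` of degree
`d = tr_Y (η_Yᵐ) > 0` (`trace_pow_of_isHyperplaneClass`), so that
`tr_{X×Y} ((α ∪ 1) ∪ pr_X* y) = d⁻¹ · tr_X (x ∪ y) · tr_Y (η_Yᵐ) = tr_X (x ∪ y)`
(`trace_externalCup`). Positivity of `m` provides `η_Y`; `⋆` exists by `starOp` under hard
Lefschetz. [cite: Andre1996Motifs, §2.1 remark following Déf. 1 (p. 14)] -/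
theorem isMotivatedClassModelledOn_of_mem_ratAlgebraicClasses (hL : W.HasHardLefschetz)
    (hX : IsSmoothProjective n X) {m : ℕ} {Y : SchemeOver k} (hY𝒱 : Y ∈ 𝒱)
    (hY : IsSmoothProjective m Y) (hm : 1 ≤ m) {p : ℕ} {x : W.obj X (2 * p)}
    (hx : x ∈ W.ratAlgebraicClasses X p) : W.IsMotivatedClassModelledOn 𝒱 n X p x := by
  have hXY : IsSmoothProjective (n + m) (X ⊗ Y) := IsSmoothProjective.tensor_holds hX hY
  obtain ⟨η, hη⟩ := W.isHyperplaneClass_nonempty hXY (le_add_left hm)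
  obtain ⟨ηY, hηY⟩ := W.isHyperplaneClass_nonempty hY hm
  obtain ⟨d, hd, hdtr⟩ := W.trace_pow_of_isHyperplaneClass hY ηY hηY
  have hdK : (d : K) ≠ 0 := Nat.cast_ne_zero.mpr hd.ne'
  have hS := W.isLefschetzStar_starOp hL hXY hη
  have h2pm : 2 * p + 2 * m = 2 * (p + m) := by omega
  refine ⟨m, Y, hY𝒱, hY, η, hη, W.starOp hL hXY hη, hS, p + m, n + m, 0, rfl, rfl,
    (d : K)⁻¹ • W.externalCup X Y h2pm x (W.pow Y ηY m), W.pow (X ⊗ Y) η (n + m), ?_, ?_, ?_⟩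
  · -- `α = d⁻¹ · (pr_X* x ∪ pr_Y* η_Yᵐ)` is rational algebraic
    refine W.inv_natCast_smul_mem_ratAlgebraicClasses ?_ hd.ne'
    rw [W.externalCup_apply]
    exact W.cup_mem_ratAlgebraicClasses hXY (p := p) (q := m) (r := p + m) rfl _ _
      (W.pullback_mem_ratAlgebraicClasses hXY hX (fst X Y) hx)
      (W.pullback_mem_ratAlgebraicClasses hXY hY (snd X Y)
        (pow_mem_ratAlgebraicClasses_of_pos hY hηY hm))
  · -- `β = ηⁿ⁺ᵐ` is rational algebraic
    exact pow_mem_ratAlgebraicClasses_of_pos hXY hη (le_add_left hm)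
  · -- the projection formula `tr_X (x ∪ y) = tr_{X×Y} ((α ∪ ⋆β) ∪ pr_X* y)`
    intro q hq y
    have hc1 : W.cup (show 2 * (p + m) + 2 * 0 = 2 * (p + m) by omega)
        ((d : K)⁻¹ • W.externalCup X Y h2pm x (W.pow Y ηY m)) (W.one (X ⊗ Y)) =
        (d : K)⁻¹ • W.externalCup X Y h2pm x (W.pow Y ηY m) :=
      W.cup_one hXY _ _
    have hjl : 2 * m + 2 * q = 2 * q + 2 * m := by omega
    have hjl' : 2 * q + 2 * m = 2 * q + 2 * m := rfl
    have H2 : 2 * p + (2 * q + 2 * m) = 2 * (n + m) := by omega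
    have h₇ : 2 * p + 2 * q = 2 * n := by omega
    have H : 2 * n + 2 * m = 2 * (n + m) := by omega
    rw [W.isLefschetzStar_apply_pow hXY hS, hc1, LinearMap.map_smul₂, map_smul, smul_eq_mul,
      W.externalCup_apply,
      W.cup_assoc hXY h2pm hjl (show 2 * (p + m) + 2 * q = 2 * (n + m) by omega) H2,
      W.cup_comm_of_even hXY hjl hjl' (Or.inl (even_two_mul m))
        (W.pullback (snd X Y) (2 * m) (W.pow Y ηY m)) (W.pullback (fst X Y) (2 * q) y),
      ← W.cup_assoc hXY h₇ hjl' H H2, ← W.map_cup hXY hX (fst X Y) h₇ x y,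
      ← W.externalCup_apply, W.trace_externalCup hX hY, hdtr,
      mul_comm _ (d : K), ← mul_assoc, inv_mul_cancel₀ hdK, one_mul]
    rfl

/-- `Aᵖ(X) ≤ A_mot^p(X)_𝒱` as `K`-subspaces of `H²ᵖ(X)`, under hard Lefschetz, for every class
`𝒱` containing a smooth projective variety of positive dimension.
[cite: Andre1996Motifs, §2.1 remark following Déf. 1 (p. 14)] -/
theorem algebraicClasses_le_motivatedClassesModelledOn (hL : W.HasHardLefschetz)
    (hX : IsSmoothProjective n X) {m : ℕ} {Y : SchemeOver k} (hY𝒱 : Y ∈ 𝒱)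
    (hY : IsSmoothProjective m Y) (hm : 1 ≤ m) (p : ℕ) :
    W.algebraicClasses X p ≤ W.motivatedClassesModelledOn 𝒱 n X p :=
  Submodule.span_le.mpr fun _ hx ↦
    (isMotivatedClassModelledOn_of_mem_ratAlgebraicClasses hL hX hY𝒱 hY hm
      (W.algebraicLattice_le_ratAlgebraicClasses X p hx)).mem_motivatedClassesModelledOn

/-- **`A_mot(X)_𝒱 = A(X)` when `⋆` is algebraic on the pieces** (André 1996 §0.3 / §2.1 p. 14),
as an equality of `K`-subspaces of `H²ᵖ(X)`: under hard Lefschetz, if `B` (`θ`-form, all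
hyperplane classes) holds for the auxiliary products `X × Y`, `Y ∈ 𝒱`, and `𝒱` contains one
smooth projective variety of positive dimension, then `A_mot^p(X)_𝒱 = Aᵖ(X)`.
[cite: Andre1996Motifs, §0.3 (p. 7) and §2.1 remark following Déf. 1 (p. 14)] -/
theorem motivatedClassesModelledOn_eq_algebraicClasses (hL : W.HasHardLefschetz)
    (hB : ∀ ⦃m : ℕ⦄ ⦃Y : SchemeOver k⦄, Y ∈ 𝒱 → IsSmoothProjective m Y →
      ∀ ⦃η : W.obj (X ⊗ Y) 2⦄, W.IsHyperplaneClass (X ⊗ Y) η →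
        W.StandardConjectureB (n + m) (X ⊗ Y) η)
    (hX : IsSmoothProjective n X) {m : ℕ} {Y : SchemeOver k} (hY𝒱 : Y ∈ 𝒱)
    (hY : IsSmoothProjective m Y) (hm : 1 ≤ m) (p : ℕ) :
    W.motivatedClassesModelledOn 𝒱 n X p = W.algebraicClasses X p :=
  le_antisymm (motivatedClassesModelledOn_le_algebraicClasses hL hB hX p)
    (algebraicClasses_le_motivatedClassesModelledOn hL hX hY𝒱 hY hm p)

end WeilCohomology

end Literature.AlgebraicGeometry.Motives

end
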